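import Literature.Topology.FourManifolds.DiffeotopyTransport
import Literature.Topology.FourManifolds.ClosedBallSmoothMaps
import Literature.Topology.FourManifolds.PalaisBallComplement
import Literature.Geometry.Conformal.MoebiusStereographic
import HarnessLib

/-!
# Isometries of the sphere up to diffeotopy; isometries and stereographic charts

Topic `Literature/Topology/FourManifolds`. Second toolkit file (after `DiffeotopyTransport.lean`)
for the reduction of Cerf's Théorème 1 (`π₀ Diff⁺ S³ = 0`) to `π₀(Diff(D³; S²)) = 0`
(Cerf 1968, Ch. I §2 (2) and Appendice, Proposition 4), `CerfPropositionFour.lean`. Everything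
here is PROVED, for the unit sphere `𝕊ⁿ ⊆ ℝⁿ⁺¹` and all `n`.

## Contents

* `Literature.Topology.FourManifolds.Diffeotopy.ofLinearIsometryFamily`: a smooth one-parameter family of linear isometries
  of `ℝⁿ⁺¹` starting at the identity restricts to a diffeotopy of `𝕊ⁿ` (stages `sphereCongr`,
  `ClosedBallSmoothMaps.lean`; joint smoothness on `ℝ × ℝⁿ⁺¹` is fed in through
  `Literature.Topology.FourManifolds.contMDiff_prod_self_of_contDiff` of `DiffeotopyTransport.lean`).
* `Literature.Topology.FourManifolds.Diffeomorph.isDiffeotopicToId_sphereCongr_reflection_trans`: **the composite of two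
  hyperplane reflections of `𝕊ⁿ` is diffeotopic to the identity** — move the second mirror
  onto the first along the segment of normal vectors (a smooth path of rotations).
* `Literature.Topology.FourManifolds.Diffeomorph.isDiffeotopicToId_or_isDiffeotopic_sphereReflection_sphereCongr`: by the
  Cartan–Dieudonné theorem (Mathlib `LinearIsometryEquiv.reflections_generate_dim`: every
  isometry of `ℝⁿ⁺¹` is a product of at most `n + 1` hyperplane reflections) **every isometry of
  `𝕊ⁿ` is diffeotopic either to the identity or to a fixed hyperplane reflection**
  `sphereReflection v` (`π₀ O(n+1) = ℤ/2` seen inside `Diff 𝕊ⁿ`).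
* `Literature.Topology.FourManifolds.exists_linearIsometryEquiv_stereographic'_conj`: **isometries act linearly in
  stereographic charts** — for poles `p q ∈ 𝕊ⁿ` and every linear isometry `B` of `ℝⁿ` there is a
  linear isometry `J` of `ℝⁿ⁺¹` with `J p = q` and `σ_q ∘ J = B ∘ σ_p` on `𝕊ⁿ`, where
  `σ_p = stereographic' n p` is Mathlib's chart from the pole `p` (the isometry `J` is assembled
  from `B` conjugated by Mathlib's identifications `pᗮ ≃ ℝⁿ`, `qᗮ ≃ ℝⁿ`, and `⟪p, ·⟫ q`).

## References

* J. Cerf, *Sur les difféomorphismes de la sphère de dimension trois (Γ₄ = 0)*, LNM 53 (1968),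
  Appendice §5, Proposition 4 (the summand `π_i(SO(n+1))` of `π_i(Diff Sⁿ)`). [CerfDiffeoSphere1968]
* M. W. Hirsch, *Differential Topology*, GTM 33 (1976), Ch. 8 §1. [HirschDT1976]
-/

open scoped Manifold ContDiff Topology RealInnerProductSpace
open Function Set Module

noncomputable section

namespace Literature.Topology.FourManifolds

/-- Local notation: `𝔼 n` is the model Euclidean space `EuclideanSpace ℝ (Fin n)`. -/
local notation "𝔼 " n:arg => EuclideanSpace ℝ (Fin n)

/-- Local notation: `𝕊 n` is the unit sphere in `EuclideanSpace ℝ (Fin (n + 1))`. -/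
local notation "𝕊 " n:arg => (Metric.sphere (0 : EuclideanSpace ℝ (Fin (n + 1))) 1)

attribute [local instance] fact_finrank_euclideanSpace_succ

variable {n : ℕ}

/-! ## `sphereCongr` is a homomorphism -/

/-- `sphereCongr` of a composite is the composite. [folklore] -/
theorem sphereCongr_trans (A B : 𝔼 (n + 1) ≃ₗᵢ[ℝ] 𝔼 (n + 1)) :
    sphereCongr (A.trans B) = (sphereCongr A).trans (sphereCongr B) :=
  Diffeomorph.ext fun _ => Subtype.ext rfl

/-- `sphereCongr` of the identity is the identity. [folklore] -/
theorem sphereCongr_refl :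
    sphereCongr (LinearIsometryEquiv.refl ℝ (𝔼 (n + 1))) = Diffeomorph.refl (𝓡 n) (𝕊 n) ∞ :=
  Diffeomorph.ext fun _ => Subtype.ext rfl

/-- `sphereCongr 1 = id`. [folklore] -/
theorem sphereCongr_one :
    sphereCongr (1 : 𝔼 (n + 1) ≃ₗᵢ[ℝ] 𝔼 (n + 1)) = Diffeomorph.refl (𝓡 n) (𝕊 n) ∞ :=
  Diffeomorph.ext fun _ => Subtype.ext rfl

/-- `sphereCongr` turns the group product `A * B = B ≫ A` into `sphereCongr B ≫ sphereCongr A`.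
[folklore] -/
theorem sphereCongr_mul (A B : 𝔼 (n + 1) ≃ₗᵢ[ℝ] 𝔼 (n + 1)) :
    sphereCongr (A * B) = (sphereCongr B).trans (sphereCongr A) := by
  rw [LinearIsometryEquiv.mul_def, sphereCongr_trans]

/-- Two isometries with the same action give the same sphere diffeomorphism. [folklore] -/
theorem sphereCongr_congr {A B : 𝔼 (n + 1) ≃ₗᵢ[ℝ] 𝔼 (n + 1)} (h : ∀ x, A x = B x) :
    sphereCongr (n := n) A = sphereCongr B :=
  Diffeomorph.ext fun x => Subtype.ext (h x)

/-! ## Smooth families of isometries are diffeotopies of the sphere -/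

namespace Diffeotopy

/-- **A smooth one-parameter family of linear isometries of `ℝⁿ⁺¹` starting at the identity is a
diffeotopy of `𝕊ⁿ`** (stages `sphereCongr (A t)`): joint smoothness of `(t, x) ↦ A t x` and of
`(t, y) ↦ (A t)⁻¹ y` is inherited by the restrictions to the sphere
(`ContMDiff.codRestrict_sphere`). [folklore] -/
def ofLinearIsometryFamily (A : ℝ → 𝔼 (n + 1) ≃ₗᵢ[ℝ] 𝔼 (n + 1))
    (hA : ContDiff ℝ ∞ fun p : ℝ × 𝔼 (n + 1) => A p.1 p.2)
    (hA' : ContDiff ℝ ∞ fun p : ℝ × 𝔼 (n + 1) => (A p.1).symm p.2)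
    (h0 : A 0 = LinearIsometryEquiv.refl ℝ (𝔼 (n + 1))) : Diffeotopy (𝓡 n) (𝕊 n) :=
  Diffeotopy.mk' (𝓡 n) (fun t x => sphereCongr (A t) x) (fun t y => (sphereCongr (A t)).symm y)
    (by
      have h1 : ContMDiff (𝓘(ℝ, ℝ).prod (𝓡 n)) 𝓘(ℝ, 𝔼 (n + 1)) ∞
          fun p : ℝ × (𝕊 n) => A p.1 (p.2 : 𝔼 (n + 1)) :=
        (contMDiff_prod_self_of_contDiff hA).comp (f := fun p : ℝ × (𝕊 n) => (p.1, (p.2 : 𝔼 (n + 1))))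
          (contMDiff_fst.prodMk (contMDiff_coe_sphere.comp contMDiff_snd))
      exact h1.codRestrict_sphere fun p => by simp [norm_eq_of_mem_sphere])
    (by
      have h1 : ContMDiff (𝓘(ℝ, ℝ).prod (𝓡 n)) 𝓘(ℝ, 𝔼 (n + 1)) ∞
          fun p : ℝ × (𝕊 n) => (A p.1).symm (p.2 : 𝔼 (n + 1)) :=
        (contMDiff_prod_self_of_contDiff hA').comp (f := fun p : ℝ × (𝕊 n) => (p.1, (p.2 : 𝔼 (n + 1))))
          (contMDiff_fst.prodMk (contMDiff_coe_sphere.comp contMDiff_snd))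
      exact h1.codRestrict_sphere fun p => by simp [norm_eq_of_mem_sphere])
    (fun t x => (sphereCongr (A t)).symm_apply_apply x)
    (fun t y => (sphereCongr (A t)).apply_symm_apply y)
    (by funext x; rw [h0, sphereCongr_refl]; rfl)

/-- Stages of the diffeotopy of a smooth family of isometries. [folklore] -/
theorem ofLinearIsometryFamily_stage (A : ℝ → 𝔼 (n + 1) ≃ₗᵢ[ℝ] 𝔼 (n + 1))
    (hA : ContDiff ℝ ∞ fun p : ℝ × 𝔼 (n + 1) => A p.1 p.2)
    (hA' : ContDiff ℝ ∞ fun p : ℝ × 𝔼 (n + 1) => (A p.1).symm p.2)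
    (h0 : A 0 = LinearIsometryEquiv.refl ℝ (𝔼 (n + 1))) (t : ℝ) :
    (ofLinearIsometryFamily A hA hA' h0).stage t = sphereCongr (A t) :=
  Diffeomorph.ext fun _ => rfl

end Diffeotopy

/-! ## Hyperplane reflections -/

/-- The hyperplane reflection of `ℝⁿ⁺¹` with (nonzero) normal vector `u`: `x ↦ x − 2 (⟪u, x⟫/‖u‖²) u`
(Mathlib `Submodule.reflection (ℝ ∙ u)ᗮ`). [folklore] -/
theorem reflection_orthogonal_singleton_apply (u x : 𝔼 (n + 1)) :
    (ℝ ∙ u)ᗮ.reflection x = x - (2 * ⟪u, x⟫ / ‖u‖ ^ 2) • u := by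
  rw [Submodule.reflection_orthogonal_apply, Submodule.reflection_apply,
    Submodule.starProjection_singleton ℝ x]
  simp only [RCLike.ofReal_real_eq_id, id_eq, neg_sub]
  congr 1
  rw [show (2 : ℝ) * ⟪u, x⟫ / ‖u‖ ^ 2 = 2 * (⟪u, x⟫ / ‖u‖ ^ 2) by ring]
  rw [← smul_smul, two_smul, two_smul]

/-- Proportional normal vectors give the same reflection. [folklore] -/
theorem reflection_orthogonal_singleton_smul {t : ℝ} (ht : t ≠ 0) (u : 𝔼 (n + 1)) :
    (ℝ ∙ t • u)ᗮ.reflection = (ℝ ∙ u)ᗮ.reflection := by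
  have h : (ℝ ∙ t • u) = ℝ ∙ u := Submodule.span_singleton_smul_eq (IsUnit.mk0 t ht) u
  exact LinearIsometryEquiv.ext fun x => by simp_rw [h]

/-- The zero "normal vector" gives the identity (`(ℝ ∙ 0)ᗮ = ⊤`). [folklore] -/
theorem reflection_orthogonal_singleton_zero (x : 𝔼 (n + 1)) :
    (ℝ ∙ (0 : 𝔼 (n + 1)))ᗮ.reflection x = x := by
  rw [reflection_orthogonal_singleton_apply]
  simp

/-- **Joint smoothness of a moving reflection**: if `c : ℝ → ℝⁿ⁺¹` is smooth and never zero,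
`(s, x) ↦ ρ_{c(s)}(x) = x − 2 (⟪c s, x⟫/‖c s‖²) c s` is smooth. [folklore] -/
theorem contDiff_reflection_family {c : ℝ → 𝔼 (n + 1)} (hc : ContDiff ℝ ∞ c)
    (hc0 : ∀ s, c s ≠ 0) {f : ℝ × 𝔼 (n + 1) → 𝔼 (n + 1)} (hf : ContDiff ℝ ∞ f) :
    ContDiff ℝ ∞ fun p : ℝ × 𝔼 (n + 1) => (ℝ ∙ c p.1)ᗮ.reflection (f p) := by
  have h : (fun p : ℝ × 𝔼 (n + 1) => (ℝ ∙ c p.1)ᗮ.reflection (f p)) =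
      fun p : ℝ × 𝔼 (n + 1) => f p - (2 * ⟪c p.1, f p⟫ / ‖c p.1‖ ^ 2) • c p.1 := by
    funext p; exact reflection_orthogonal_singleton_apply _ _
  rw [h]
  have hc1 : ContDiff ℝ ∞ fun p : ℝ × 𝔼 (n + 1) => c p.1 := hc.comp contDiff_fst
  refine hf.sub (ContDiff.smul (ContDiff.div ?_ ?_ fun p => ?_) hc1)
  · exact contDiff_const.mul (hc1.inner ℝ hf)
  · exact (contDiff_norm_sq ℝ).comp hc1
  · exact pow_ne_zero 2 (norm_ne_zero_iff.mpr (hc0 p.1))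

/-- The one-parameter family of isometries `s ↦ ρ_{c(0)} ∘ ρ_{c(s)}` attached to a curve `c` of
normal vectors (a family of rotations when `c` moves in a plane). [folklore] -/
def reflectionPair (c : ℝ → 𝔼 (n + 1)) (s : ℝ) : 𝔼 (n + 1) ≃ₗᵢ[ℝ] 𝔼 (n + 1) :=
  ((ℝ ∙ c s)ᗮ.reflection).trans (ℝ ∙ c 0)ᗮ.reflection

/-- Action of `reflectionPair c s`. [folklore] -/
theorem reflectionPair_apply (c : ℝ → 𝔼 (n + 1)) (s : ℝ) (x : 𝔼 (n + 1)) :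
    reflectionPair c s x = (ℝ ∙ c 0)ᗮ.reflection ((ℝ ∙ c s)ᗮ.reflection x) :=
  rfl

/-- Action of the inverse of `reflectionPair c s` (reflections are involutions). [folklore] -/
theorem reflectionPair_symm_apply (c : ℝ → 𝔼 (n + 1)) (s : ℝ) (x : 𝔼 (n + 1)) :
    (reflectionPair c s).symm x = (ℝ ∙ c s)ᗮ.reflection ((ℝ ∙ c 0)ᗮ.reflection x) := by
  rw [reflectionPair, LinearIsometryEquiv.symm_trans, LinearIsometryEquiv.trans_apply,
    Submodule.reflection_symm, Submodule.reflection_symm]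

/-- The family starts at the identity. [folklore] -/
theorem reflectionPair_zero (c : ℝ → 𝔼 (n + 1)) :
    reflectionPair c 0 = LinearIsometryEquiv.refl ℝ (𝔼 (n + 1)) :=
  Submodule.reflection_trans_reflection _

namespace Diffeomorph

/-- **The composite of two hyperplane reflections of `𝕊ⁿ` is diffeotopic to the identity.** If the
normals `a, b` are proportional the composite is the identity; otherwise the segment
`c(s) = (1 − s) b + s a` misses `0`, and `s ↦ ρ_{c(0)} ∘ ρ_{c(s)}` is a smooth path of isometries
(rotations in the plane of `a, b`) from the identity to `ρ_b ∘ ρ_a`. [folklore] -/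
theorem isDiffeotopicToId_sphereCongr_reflection_trans {a b : 𝔼 (n + 1)} (ha : a ≠ 0)
    (hb : b ≠ 0) :
    IsDiffeotopicToId
      ((sphereCongr (n := n) (ℝ ∙ a)ᗮ.reflection).trans (sphereCongr (ℝ ∙ b)ᗮ.reflection)) := by
  by_cases hdep : ∃ t : ℝ, b = t • a
  · -- proportional normals: the composite is the identity
    obtain ⟨t, rfl⟩ := hdep
    have ht : t ≠ 0 := by
      rintro rfl
      exact hb (zero_smul ℝ a)
    rw [reflection_orthogonal_singleton_smul ht]
    have h1 : (sphereCongr (n := n) (ℝ ∙ a)ᗮ.reflection).trans (sphereCongr (ℝ ∙ a)ᗮ.reflection) =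
        Diffeomorph.refl (𝓡 n) (𝕊 n) ∞ :=
      Diffeomorph.ext fun x => Subtype.ext (Submodule.reflection_reflection _ _)
    rw [h1]
    exact isDiffeotopicToId_refl
  · -- independent normals: rotate the second mirror onto the first
    set c : ℝ → 𝔼 (n + 1) := fun s => (1 - s) • b + s • a with hc
    have hc0 : ∀ s, c s ≠ 0 := by
      intro s hs
      simp only [hc] at hs
      by_cases h1 : s = 1
      · subst h1
        simp at hs
        exact ha hs
      · have h1' : (1 - s) ≠ 0 := sub_ne_zero.mpr (Ne.symm h1)
        apply hdep
        refine ⟨-(s / (1 - s)), ?_⟩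
        have h2 : (1 - s) • b = -(s • a) := eq_neg_of_add_eq_zero_left hs
        calc b = (1 - s)⁻¹ • ((1 - s) • b) := by rw [smul_smul, inv_mul_cancel₀ h1', one_smul]
          _ = -(s / (1 - s)) • a := by
            rw [h2, smul_neg, smul_smul, ← neg_smul]
            congr 1
            rw [div_eq_inv_mul]
    have hcs : ContDiff ℝ ∞ c :=
      ((contDiff_const.sub contDiff_id).smul contDiff_const).add (contDiff_id.smul contDiff_const)
    have hc00 : c 0 = b := by simp [hc]
    have hc1 : c 1 = a := by simp [hc]
    have hAf : ContDiff ℝ ∞ fun p : ℝ × 𝔼 (n + 1) => reflectionPair c p.1 p.2 := by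
      simp_rw [reflectionPair_apply]
      exact (LinearIsometryEquiv.contDiff _).comp (contDiff_reflection_family hcs hc0 contDiff_snd)
    have hAf' : ContDiff ℝ ∞ fun p : ℝ × 𝔼 (n + 1) => (reflectionPair c p.1).symm p.2 := by
      simp_rw [reflectionPair_symm_apply]
      exact contDiff_reflection_family hcs hc0
        ((LinearIsometryEquiv.contDiff _).comp contDiff_snd)
    refine ⟨Diffeotopy.ofLinearIsometryFamily (reflectionPair c) hAf hAf' (reflectionPair_zero c), ?_⟩
    rw [Diffeotopy.ofLinearIsometryFamily_stage]
    refine Diffeomorph.ext fun x => Subtype.ext ?_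
    simp only [Diffeomorph.coe_trans, comp_apply, coe_sphereCongr, reflectionPair_apply, hc1, hc00]

/-- Any two hyperplane reflections of `𝕊ⁿ` are diffeotopic. [folklore] -/
theorem isDiffeotopic_sphereCongr_reflection {a b : 𝔼 (n + 1)} (ha : a ≠ 0) (hb : b ≠ 0) :
    IsDiffeotopic (sphereCongr (n := n) (ℝ ∙ a)ᗮ.reflection) (sphereCongr (ℝ ∙ b)ᗮ.reflection) := by
  rw [isDiffeotopic_iff, sphereCongr_symm, Submodule.reflection_symm]
  exact isDiffeotopicToId_sphereCongr_reflection_trans ha hb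

/-- **Every isometry of `𝕊ⁿ` is diffeotopic to the identity or to a fixed hyperplane
reflection.** By the Cartan–Dieudonné theorem (Mathlib
`LinearIsometryEquiv.reflections_generate_dim`) the isometry is a product of hyperplane
reflections; composites of two reflections are diffeotopic to the identity
(`isDiffeotopicToId_sphereCongr_reflection_trans`) and any two reflections are diffeotopic, so
an induction on the number of factors concludes (`π₀ O(n+1) = ℤ/2`, mapped into `Diff 𝕊ⁿ`;
cf. the summand `π₀ SO(n+1) = 0` in Cerf (1968), Appendice, Prop. 4). [folklore] -/
theorem isDiffeotopicToId_or_isDiffeotopic_sphereReflection_sphereCongr (v : 𝕊 n)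
    (J : 𝔼 (n + 1) ≃ₗᵢ[ℝ] 𝔼 (n + 1)) :
    IsDiffeotopicToId (sphereCongr J) ∨ IsDiffeotopic (sphereReflection v) (sphereCongr J) := by
  have hv0 : (v : 𝔼 (n + 1)) ≠ 0 := ne_zero_of_mem_unit_sphere v
  obtain ⟨l, -, rfl⟩ := J.reflections_generate_dim
  induction l with
  | nil =>
    left
    rw [List.map_nil, List.prod_nil, sphereCongr_one]
    exact isDiffeotopicToId_refl
  | cons w l ih =>
    rw [List.map_cons, List.prod_cons, sphereCongr_mul]
    by_cases hw : w = 0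
    · -- a zero vector contributes the identity
      subst hw
      have h1 : sphereCongr (n := n) (ℝ ∙ (0 : 𝔼 (n + 1)))ᗮ.reflection =
          Diffeomorph.refl (𝓡 n) (𝕊 n) ∞ :=
        Diffeomorph.ext fun x => Subtype.ext (reflection_orthogonal_singleton_zero _)
      rw [h1, Diffeomorph.trans_refl]
      exact ih
    rcases ih with h | h
    · -- `X ~ id`: then `X ≫ ρ_w ~ ρ_w ~ ρ_v`
      right
      rw [sphereReflection_eq_sphereCongr]
      exact (isDiffeotopic_sphereCongr_reflection hv0 hw).trans
        (isDiffeotopic_trans_of_isDiffeotopicToId' _ h)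
    · -- `ρ_v ~ X`: then `X ≫ ρ_w ~ ρ_v ≫ ρ_w ~ id`
      left
      rw [sphereReflection_eq_sphereCongr] at h
      exact (h.trans_right _).isDiffeotopicToId
        (isDiffeotopicToId_sphereCongr_reflection_trans hv0 hw)

/-- Hence a diffeomorphism of `𝕊ⁿ` diffeotopic to an isometry is diffeotopic to the identity or to
the fixed reflection `sphereReflection v`. [folklore] -/
theorem isDiffeotopicToId_or_isDiffeotopic_sphereReflection_of_isDiffeotopic_sphereCongr
    (v : 𝕊 n) {J : 𝔼 (n + 1) ≃ₗᵢ[ℝ] 𝔼 (n + 1)} {φ : (𝕊 n) ≃ₘ⟮𝓡 n, 𝓡 n⟯ (𝕊 n)}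
    (h : IsDiffeotopic (sphereCongr J) φ) :
    IsDiffeotopicToId φ ∨ IsDiffeotopic (sphereReflection v) φ := by
  rcases isDiffeotopicToId_or_isDiffeotopic_sphereReflection_sphereCongr v J with hJ | hJ
  · exact Or.inl (h.isDiffeotopicToId hJ)
  · exact Or.inr (hJ.trans h)

end Diffeomorph

/-! ## Isometries act linearly in stereographic charts -/

section Stereographic

/-- Unfolding Mathlib's `stereographic'`: `σ_p x = U_p ((2 / (1 − ⟪p, x⟫)) • P_{pᗮ} x)`, with
`U_p = Literature.Conformal.stereoIsometry n p : pᗮ ≃ₗᵢ ℝⁿ` the frame used by `stereographic' n p`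
(`Literature/Geometry/Conformal/MoebiusStereographic.lean`). [folklore] -/
theorem stereographic'_apply_eq (p x : 𝕊 n) :
    stereographic' n p x =
      Literature.Geometry.Conformal.stereoIsometry n p ((2 / (1 - ⟪(p : 𝔼 (n + 1)), x⟫)) •
        (ℝ ∙ (p : 𝔼 (n + 1)))ᗮ.orthogonalProjectionOnto (x : 𝔼 (n + 1))) := by
  show Literature.Geometry.Conformal.stereoIsometry n p (stereographic (norm_eq_of_mem_sphere p) x) = _
  rw [stereographic_apply]

/-- **Isometries act linearly in stereographic charts.** For poles `p, q ∈ 𝕊ⁿ` and every linear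
isometry `B` of `ℝⁿ` there is a linear isometry `J` of `ℝⁿ⁺¹` with `J p = q` whose action on the
sphere reads `B` in the stereographic charts from `p` and `q`: `σ_q (J x) = B (σ_p x)` for all
`x ∈ 𝕊ⁿ` (Mathlib `stereographic'`). The isometry is
`J x = U_q⁻¹ (B (U_p (P_{pᗮ} x))) + ⟪p, x⟫ q`, `U_p = Literature.Conformal.stereoIsometry n p : pᗮ ≃ ℝⁿ`
being the frame used by `stereographic' n p`; it is the two-pole analogue of
`Literature.Geometry.Conformal.extendIsometry` (`MoebiusStereographic.lean`, the case `p = q`). [folklore] -/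
theorem exists_linearIsometryEquiv_stereographic'_conj (p q : 𝕊 n)
    (B : 𝔼 n ≃ₗᵢ[ℝ] 𝔼 n) :
    ∃ J : 𝔼 (n + 1) ≃ₗᵢ[ℝ] 𝔼 (n + 1), J p = q ∧
      ∀ x : 𝕊 n, stereographic' n q (sphereCongr J x) = B (stereographic' n p x) := by
  have hp1 : ‖(p : 𝔼 (n + 1))‖ = 1 := norm_eq_of_mem_sphere p
  have hq1 : ‖(q : 𝔼 (n + 1))‖ = 1 := norm_eq_of_mem_sphere q
  have hpp : ⟪(p : 𝔼 (n + 1)), p⟫ = 1 := by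
    rw [real_inner_self_eq_norm_sq, hp1, one_pow]
  have hqq : ⟪(q : 𝔼 (n + 1)), q⟫ = 1 := by
    rw [real_inner_self_eq_norm_sq, hq1, one_pow]
  -- the tangential part `T x = U_q⁻¹ (B (U_p (P x))) ∈ qᗮ`, as a linear map into `ℝⁿ⁺¹`
  set T : 𝔼 (n + 1) →ₗ[ℝ] 𝔼 (n + 1) :=
    (ℝ ∙ (q : 𝔼 (n + 1)))ᗮ.subtype ∘ₗ ((Literature.Geometry.Conformal.stereoIsometry n q).symm.toLinearEquiv.toLinearMap ∘ₗ
      (B.toLinearEquiv.toLinearMap ∘ₗ ((Literature.Geometry.Conformal.stereoIsometry n p).toLinearEquiv.toLinearMap ∘ₗ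
        ((ℝ ∙ (p : 𝔼 (n + 1)))ᗮ.orthogonalProjectionOnto : 𝔼 (n + 1) →L[ℝ] (ℝ ∙ (p : 𝔼 (n + 1)))ᗮ).toLinearMap))) with hT
  have hT_apply : ∀ x, T x = ((Literature.Geometry.Conformal.stereoIsometry n q).symm (B (Literature.Geometry.Conformal.stereoIsometry n p
      ((ℝ ∙ (p : 𝔼 (n + 1)))ᗮ.orthogonalProjectionOnto x))) : 𝔼 (n + 1)) := fun x => rfl
  have hT_mem : ∀ x, T x ∈ (ℝ ∙ (q : 𝔼 (n + 1)))ᗮ := fun x => by rw [hT_apply]; exact Subtype.mem _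
  have hT_norm : ∀ x, ‖T x‖ = ‖((ℝ ∙ (p : 𝔼 (n + 1)))ᗮ.orthogonalProjectionOnto x : 𝔼 (n + 1))‖ := fun x => by
    rw [hT_apply, ← Submodule.coe_norm, LinearIsometryEquiv.norm_map, LinearIsometryEquiv.norm_map,
      LinearIsometryEquiv.norm_map, Submodule.coe_norm]
  -- the normal part `⟪p, x⟫ q`
  set N : 𝔼 (n + 1) →ₗ[ℝ] 𝔼 (n + 1) :=
    (LinearMap.toSpanSingleton ℝ (𝔼 (n + 1)) (q : 𝔼 (n + 1))) ∘ₗ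
      (innerₛₗ ℝ (p : 𝔼 (n + 1)) : 𝔼 (n + 1) →ₗ[ℝ] ℝ) with hN
  have hN_apply : ∀ x, N x = ⟪(p : 𝔼 (n + 1)), x⟫ • (q : 𝔼 (n + 1)) := fun x => rfl
  -- `J₀ = T + N` preserves norms
  set J₀ : 𝔼 (n + 1) →ₗ[ℝ] 𝔼 (n + 1) := T + N with hJ₀
  have hJ₀_apply : ∀ x, J₀ x = T x + ⟪(p : 𝔼 (n + 1)), x⟫ • (q : 𝔼 (n + 1)) := fun x => rfl
  have horth : ∀ x, ⟪T x, ⟪(p : 𝔼 (n + 1)), x⟫ • (q : 𝔼 (n + 1))⟫ = 0 := fun x => by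
    rw [inner_smul_right]
    have : ⟪T x, (q : 𝔼 (n + 1))⟫ = 0 :=
      Submodule.mem_orthogonal_singleton_iff_inner_left.mp (hT_mem x)
    rw [this, mul_zero]
  have hPp : ∀ x : 𝔼 (n + 1), (ℝ ∙ (p : 𝔼 (n + 1))).starProjection x =
      ⟪(p : 𝔼 (n + 1)), x⟫ • (p : 𝔼 (n + 1)) := fun x => by
    rw [Submodule.starProjection_singleton ℝ x, hp1]
    simp
  have hnorm : ∀ x, ‖J₀ x‖ = ‖x‖ := by
    intro x
    have h1 : ‖J₀ x‖ ^ 2 = ‖T x‖ ^ 2 + ‖⟪(p : 𝔼 (n + 1)), x⟫ • (q : 𝔼 (n + 1))‖ ^ 2 := by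
      rw [hJ₀_apply, sq, sq, sq]
      exact norm_add_sq_eq_norm_sq_add_norm_sq_of_inner_eq_zero _ _ (horth x)
    have h2 : ‖x‖ ^ 2 = ‖(ℝ ∙ (p : 𝔼 (n + 1))).starProjection x‖ ^ 2 +
        ‖(ℝ ∙ (p : 𝔼 (n + 1)))ᗮ.starProjection x‖ ^ 2 :=
      Submodule.norm_sq_eq_add_norm_sq_starProjection x _
    have h3 : ‖J₀ x‖ ^ 2 = ‖x‖ ^ 2 := by
      rw [h1, h2, hT_norm, Submodule.coe_orthogonalProjectionOnto_apply, hPp, norm_smul,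
        norm_smul, hp1, hq1]
      ring
    have := abs_eq_abs.mpr (Or.inl h3)
    rwa [abs_eq_self.mpr (sq_nonneg _), abs_eq_self.mpr (sq_nonneg _),
      sq_eq_sq₀ (norm_nonneg _) (norm_nonneg _)] at this
  set J₁ : 𝔼 (n + 1) →ₗᵢ[ℝ] 𝔼 (n + 1) := ⟨J₀, hnorm⟩ with hJ₁
  set J : 𝔼 (n + 1) ≃ₗᵢ[ℝ] 𝔼 (n + 1) := J₁.toLinearIsometryEquiv rfl with hJ
  have hJ_apply : ∀ x, J x = T x + ⟪(p : 𝔼 (n + 1)), x⟫ • (q : 𝔼 (n + 1)) := fun x => rfl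
  -- `P_{pᗮ} p = 0`
  have hPp0 : (ℝ ∙ (p : 𝔼 (n + 1)))ᗮ.orthogonalProjectionOnto (p : 𝔼 (n + 1)) = 0 :=
    Submodule.orthogonalProjectionOnto_orthogonalComplement_singleton_eq_zero _
  refine ⟨J, ?_, fun x => ?_⟩
  · rw [hJ_apply, hT_apply, hPp0, hpp]
    simp
  · -- chart computation
    have hx := hJ_apply (x : 𝔼 (n + 1))
    rw [stereographic'_apply_eq, stereographic'_apply_eq, coe_sphereCongr]
    -- `⟪q, J x⟫ = ⟪p, x⟫`
    have hinner : ⟪(q : 𝔼 (n + 1)), J x⟫ = ⟪(p : 𝔼 (n + 1)), x⟫ := by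
      rw [hx, inner_add_right, inner_smul_right, hqq, mul_one,
        Submodule.mem_orthogonal_singleton_iff_inner_right.mp (hT_mem _), zero_add]
    -- `P_{qᗮ} (J x) = T x`
    have hproj : (ℝ ∙ (q : 𝔼 (n + 1)))ᗮ.orthogonalProjectionOnto (J (x : 𝔼 (n + 1))) =
        (Literature.Geometry.Conformal.stereoIsometry n q).symm (B (Literature.Geometry.Conformal.stereoIsometry n p ((ℝ ∙ (p : 𝔼 (n + 1)))ᗮ.orthogonalProjectionOnto (x : 𝔼 (n + 1))))) := by
      rw [hx, map_add, map_smul]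
      have h1 : (ℝ ∙ (q : 𝔼 (n + 1)))ᗮ.orthogonalProjectionOnto (q : 𝔼 (n + 1)) = 0 :=
        Submodule.orthogonalProjectionOnto_orthogonalComplement_singleton_eq_zero _
      rw [h1, smul_zero, add_zero, hT_apply, Submodule.orthogonalProjectionOnto_mem_subspace_eq_self]
    rw [hinner, hproj]
    simp only [map_smul, LinearIsometryEquiv.apply_symm_apply]

end Stereographic

end Literature.Topology.FourManifolds

end
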